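import Mathlib
import Summits.KontsevichZagierPeriods.Zeta5Search.RecordAtlasCells
import HarnessLib

/-!
# ζ(5) search — the record ray's ZERO CELLS one octave down: typed targets `N⁺`, `L⁺`, `H⁺` (DENOM-LAW D1, prover-d1 g4)

Cell `pub-zeta5`, track DENOM-LAW.  HONEST FRAMING: systematic search; statements about the `p`-adic valuation of the explicit rationals
`Cas₇(b(n))`, `b(n) = bRec n = n·(41;17,16,15,14,13,12,11)` (Brown–Zudilin record direction); OBSERVED, NOT proved — exact arithmetic:
every prime of the three cells with 2 ≤ n ≤ 24 (this seat, gen-2 g6 `pf.py` kernel) and PRE-REGISTERED for 25 ≤ n ≤ 60 (seal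
`denom-law/prover-d1/g4/prereg/PREREG-D1g4-RECORD-ZEROCELLS-25-60.json` sha256 08d0b0dc…, scored by census g46 on its PATH-A kernel rows +
engine-d2's mining table: `+` sub-cells N⁺ 35/35, L⁺ 65/65, H⁺ 19/19 exactly one unit above the cell bound, `−` sub-cells at the bound 83/85,
0 violations; INBOX 2026-08-23 l.7915/l.7917 + census l.7921); the Brown–Zudilin (28)+(30) accounting already books these units on the (M) side
(they sit exactly on the steps `k·p ≤ d = 25n` of Φ); nothing about ζ(5); no γ moves; no irrationality claim; records in print UNMOVED.

On the three ZERO cells N, L, H of gen-2 g9's structural atlas (`RecordAtlasCells`: every deep type-vector vanishes, bound `casLB + 2`, all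
tree theorems: `recordCellN_holds`, `AtlasCellRecL.holds`, `AtlasCellRecH.holds`) the exact valuation is ONE MORE than the proved bound
exactly at the primes below the next line of BZ's Φ-staircase, and there the leading-digit shift ratios `X(b+e₇)/X(b) (mod p)` of the three
dual forms `U, W, V` coincide (theory-d1 g2's family-ratio law); anatomy and the one missing identity for a proof (palindrome pairs + their
raises vs the unit-moved neighbour family): `denom-law/prover-d1/ATTEMPT-5.md` §4–4e, tables `denom-law/prover-d1/g4/tables/`.
-/

namespace Summit.KontsevichZagierPeriods.Zeta5Search.RecordAtlas

open Summit.KontsevichZagierPeriods.Zeta5Search.CasoratianValuation (casoratian)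
open Summit.KontsevichZagierPeriods.Zeta5Search.ClusterValuation (bRec)

/-- **RECORD CELL N⁺** (`8.2 < θ ≤ 25/3`, i.e. cell N with `3p ≤ d = 25n`): `v_p(Cas₇(b(n))) ≥ −10` (cell N's theorem gives `−11`).
OBSERVED: this seat's exact rows n ≤ 23 — N⁺ 6/6 at −10 ((10,83), (13,107), (19,157), (21,173), (22,181), …), N⁻ 8/8 at −11; sealed rows
25 ≤ n ≤ 60 (census g46 score) — N⁺ 35/35 at −10, N⁻ 41/42 at −11 (one sporadic extra unit, (42,353)). -/
@[conjecture] def RecordCellNPlus : Prop :=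
  ∀ n p : ℕ, 2 ≤ n → p.Prime → 41 * n < 5 * p → 3 * p ≤ 25 * n → casoratian (bRec n) 7 ≠ 0 →
    (-10 : ℤ) ≤ padicValRat p (casoratian (bRec n) 7)

/-- **RECORD CELL L⁺** (`6 < θ ≤ 25/4`, i.e. cell L with `4p ≤ d`): `v_p(Cas₇(b(n))) ≥ −14` (cell L's theorem gives `−15`).
OBSERVED: this seat's rows n ≤ 23 — L⁺ 14/14 at −14, L⁻ 5/5 at −15 ((3,19), (17,107), (22,139), …); sealed rows 25 ≤ n ≤ 60 — L⁺ 65/65 at −14,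
L⁻ 20/20 at −15. -/
@[conjecture] def RecordCellLPlus : Prop :=
  ∀ n p : ℕ, 2 ≤ n → p.Prime → 6 * n < p → 4 * p ≤ 25 * n → casoratian (bRec n) 7 ≠ 0 →
    (-14 : ℤ) ≤ padicValRat p (casoratian (bRec n) 7)

/-- **RECORD CELL H⁺** (`4.1 < θ ≤ 25/6`, i.e. cell H with `6p ≤ d`): `v_p(Cas₇(b(n))) ≥ −22` (cell H's theorem gives `−23`).
OBSERVED: this seat's rows n ≤ 23 — H⁺ 4/4 at ≥ −22 ((7,29) −22, (9,37) −21, (20,83) −22, …), H⁻ 6/6 at −23; sealed rows 25 ≤ n ≤ 60 — H⁺ 19/19 at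
exactly −22, H⁻ 22/23 at −23 (one sporadic extra unit, (37,157)). -/
@[conjecture] def RecordCellHPlus : Prop :=
  ∀ n p : ℕ, 2 ≤ n → p.Prime → 41 * n < 10 * p → 6 * p ≤ 25 * n → casoratian (bRec n) 7 ≠ 0 →
    (-22 : ℤ) ≤ padicValRat p (casoratian (bRec n) 7)

/-- Sanity: the three sub-cells are non-empty (`(10,83) ∈ N⁺`, `(5,31) ∈ L⁺`, `(7,29) ∈ H⁺`). -/
example : (41 * 10 < 5 * 83 ∧ 3 * 83 ≤ 25 * 10) ∧ (6 * 5 < 31 ∧ 4 * 31 ≤ 25 * 5) ∧ (41 * 7 < 10 * 29 ∧ 6 * 29 ≤ 25 * 7) := by decide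

end Summit.KontsevichZagierPeriods.Zeta5Search.RecordAtlas
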